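import Mathlib.LinearAlgebra.QuadraticForm.Basic
import Mathlib.LinearAlgebra.Charpoly.Basic
import Literature.Algebra.Lie.CasimirElement
import Literature.NumberTheory.Automorphic.AutomorphicFormsStableCenter
import Literature.NumberTheory.Automorphic.AutomorphicFormsProofs
import Literature.NumberTheory.Automorphic.ArchimedeanExpChart
import HarnessLib

/-!
# Automorphic forms are annihilated by an elliptic element of `U(𝔤)`
(the Casimir element twisted by `U(𝔨)`; Harish-Chandra 1953, §11; Nelson 1959, §8; Borel 1972, 3.15)

Topic `NumberTheory/Automorphic`; helper toward the named fact `automorphicForms_isStableSubmodule`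
(Borel–Jacquet 1979, 4.3) of `AutomorphicForms` for a general regular datum, by the route
"elliptic annihilator + fundamental solution" (which avoids Harish-Chandra's admissibility
theorem): a smooth, `K_∞`-finite, `Z(𝔤)`-finite function is killed by an element of `U(𝔤)` whose
image in every exponential chart is an ELLIPTIC operator with constant (real) coefficients. Let
`H ≤ GL(N, A)` be a linear real group whose Lie algebra `𝔤` is stable under the conjugate
transpose, over a finite-dimensional coefficient algebra `A` carrying an `ℝ`-linear involution
and a positive `ℝ`-linear star-trace `tr` (`tr (a*) = tr a`, `tr (a* a) > 0` for `a ≠ 0`; e.g. the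
sum of real parts on `ℝ^{r₁} × ℂ^{r₂}`). This file PROVES:

* §1 (the forms): the real trace form `B(X, Y) = τ(XY)`, `τ = tr ∘ trace`, on `𝔤` is symmetric,
  invariant and non-degenerate; `B_θ(X, Y) = τ(X Y*)` is symmetric positive definite
  (`trForm`, `thetaForm`);
* §2 (Nelson's identity): there is a basis `c` of `𝔤` consisting of skew-hermitian (`𝔨`) and
  hermitian (`𝔭`) matrices, `B_θ`-orthonormal, whose `B`-dual basis is `∓c`; hence the Casimir
  element (`Literature.Algebra.Lie.casimirElement`, central in `U(𝔤)`) is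
  `Ω = -∑_𝔨 Yᵢ² + ∑_𝔭 Xⱼ²` and **`∑ₗ cₗ² = Ω + 2 ∑_𝔨 Yᵢ²`** in `U(𝔤)`
  (`exists_adaptedBasis`, `sum_sq_eq_casimir_add`); Harish-Chandra 1953, §11; Nelson 1959, §8;
* §3 (the annihilator, for any linear real group `H → G`): for `φ` smooth in the archimedean
  variable, `K`-finite and `Z(𝔤)`-finite, the space `V(φ) = zkSpan ι φ` spanned by the `z ψ`
  (`z` a central word, `ψ` in the `K`-span of `φ`) is finite-dimensional
  (`finiteDimensional_zkSpan`: the `K`-translates of `φ` are `Z(𝔤)`-finite), contains `φ`, is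
  stable under central words and under `𝔨` (`IsArchSmooth.lieDeriv_mem_kTranslateSpan`), hence
  under the sum-of-squares operator `L_c = ∑ₗ cₗ²` (`sqSumOp`, `sqSumOp_mem_zkSpan`); by
  Cayley–Hamilton the characteristic polynomial `χ` of `L_c` on `V(φ)` kills `φ`, and `R = χ̄ χ` is
  a real monic polynomial with **`R(L_c) φ = 0`** (`exists_real_annihilator_sqSumOp`,
  `exists_adaptedBasis_real_annihilator`). Borel 1972, 3.15–3.16 (a `Z(𝔤)`-finite `K`-finite
  vector is annihilated by an elliptic element); Harish-Chandra 1966, §8;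
* §4 (automorphic forms): for a regular datum (`𝔤` full, hence `*`-stable:
  `star_mem_lie_of_forall_expGL`) and an automorphic form `φ`, a basis `B` of `𝔤` indexed by
  `Fin d` and a real monic `R` with `R(L_B) φ = 0` pointwise on `G(𝔸)`
  (`IsAutomorphicForm.exists_elliptic_annihilator`), in the shape consumed by the exponential
  chart of `ArchimedeanExpChart` — where `R(L_B)` becomes an elliptic operator of order `2M` with
  constant real coefficients in the chart fields.

Everything here is proved; the only definitions are the forms `matTrace`, `trForm`, `thetaForm`,
the operator `sqSumOp`, the space `zkSpan` and the identity equivalence `lieEquivSubmodule`; no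
named facts. The positive star-trace `tr` is a hypothesis here (it exists for every
finite-dimensional star-formally-real `A` with `ℝ`-linear involution, `A ≅ ℝ^r × ℂ^s`).

## References

* Harish-Chandra, *Representations of a semisimple Lie group on a Banach space. I*, Trans. AMS 75
  (1953), §11 [HarishChandraTAMS1953].
* E. Nelson, *Analytic vectors*, Ann. of Math. 70 (1959), §8 [Nelson1959].
* A. Borel, *Représentations de groupes localement compacts*, LNM 276 (1972), 3.15–3.18
  [Borel1972].
* A. Borel, H. Jacquet, *Automorphic forms and automorphic representations*, Proc. Sympos. Pure
  Math. 33 (1979), Part 1, 4.3 [BorelJacquetCorvallis1979].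
-/

noncomputable section

open scoped MatrixGroups Matrix ContDiff Topology
open UniversalEnvelopingAlgebra

namespace Literature.NumberTheory.Automorphic

-- Mathlib idiom (Mathlib/Algebra/Lie/OfAssociative.lean); needed to mention Lie subalgebras of matrix algebras
attribute [local instance 100] LieRing.ofAssociativeRing

/-! ### §1 The real trace forms on `𝔤` -/

section MatTrace

variable {A : Type*} [NormedCommRing A] [NormedAlgebra ℝ A] [StarRing A] {N : Type*} [Fintype N]

/-- The real trace `τ = tr ∘ trace : 𝔤𝔩(N, A) → ℝ` attached to a real linear functional `tr` on
`A`. [folklore] -/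
def matTrace (tr : A →ₗ[ℝ] ℝ) : Matrix N N A →ₗ[ℝ] ℝ :=
  tr ∘ₗ Matrix.traceLinearMap N ℝ A

omit [StarRing A] in
/-- `τ(X) = tr (trace X)`. [folklore] -/
@[simp] theorem matTrace_apply (tr : A →ₗ[ℝ] ℝ) (X : Matrix N N A) :
    matTrace tr X = tr X.trace := rfl

omit [StarRing A] in
/-- `τ(XY) = τ(YX)`. [folklore] -/
theorem matTrace_mul_comm (tr : A →ₗ[ℝ] ℝ) (X Y : Matrix N N A) :
    matTrace tr (X * Y) = matTrace tr (Y * X) := by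
  rw [matTrace_apply, matTrace_apply, Matrix.trace_mul_comm]

/-- `τ(Xᴴ) = τ(X)` when `tr` is star-invariant. [folklore] -/
theorem matTrace_conjTranspose {tr : A →ₗ[ℝ] ℝ} (htr : ∀ a, tr (star a) = tr a)
    (X : Matrix N N A) : matTrace tr Xᴴ = matTrace tr X := by
  rw [matTrace_apply, matTrace_apply, Matrix.trace_conjTranspose, htr]

/-- `τ(X Xᴴ) = ∑ᵢⱼ tr (Xᵢⱼ* Xᵢⱼ)`. [folklore] -/
theorem matTrace_mul_conjTranspose_self (tr : A →ₗ[ℝ] ℝ) (X : Matrix N N A) :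
    matTrace tr (X * Xᴴ) = ∑ i, ∑ j, tr (star (X i j) * X i j) := by
  rw [matTrace_apply, Matrix.trace]
  simp only [Matrix.diag_apply, Matrix.mul_apply, Matrix.conjTranspose_apply, map_sum]
  refine Finset.sum_congr rfl fun i _ => Finset.sum_congr rfl fun j _ => ?_
  rw [mul_comm]

/-- Positivity: `τ(X Xᴴ) > 0` for `X ≠ 0` when `tr (a* a) > 0` for `a ≠ 0`. [folklore] -/
theorem matTrace_mul_conjTranspose_self_pos {tr : A →ₗ[ℝ] ℝ}
    (hpos : ∀ a : A, a ≠ 0 → 0 < tr (star a * a)) {X : Matrix N N A} (hX : X ≠ 0) :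
    0 < matTrace tr (X * Xᴴ) := by
  have hnn : ∀ a : A, 0 ≤ tr (star a * a) := fun a => by
    by_cases ha : a = 0
    · simp [ha]
    · exact (hpos a ha).le
  obtain ⟨i, j, hij⟩ : ∃ i j, X i j ≠ 0 := by
    by_contra h
    push Not at h
    exact hX (Matrix.ext fun i j => by simpa using h i j)
  rw [matTrace_mul_conjTranspose_self]
  refine lt_of_lt_of_le (lt_of_lt_of_le (hpos _ hij) ?_)
    (Finset.single_le_sum (f := fun i => ∑ j, tr (star (X i j) * X i j))
      (fun i _ => Finset.sum_nonneg fun j _ => hnn _) (Finset.mem_univ i))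
  exact Finset.single_le_sum (f := fun j => tr (star (X i j) * X i j)) (fun j _ => hnn _)
    (Finset.mem_univ j)

end MatTrace

section Forms

variable {A : Type*} [NormedCommRing A] [NormedAlgebra ℝ A] [NormedAlgebra ℚ A] [CompleteSpace A]
  [StarRing A] {N : Type*} [Fintype N] [DecidableEq N] {H : RealMatrixGroup A N}

/-- The **real trace form** `B(X, Y) = τ(XY)` on `𝔤 = H.lie`. Knapp 2002, I.§8 and VI.§1
(the trace form of a linear Lie algebra). [folklore] -/
def trForm (tr : A →ₗ[ℝ] ℝ) : LinearMap.BilinForm ℝ H.lie :=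
  LinearMap.mk₂ ℝ (fun X Y : H.lie => matTrace tr ((X : Matrix N N A) * (Y : Matrix N N A)))
    (fun X X' Y => by
      change matTrace tr (((X : Matrix N N A) + (X' : Matrix N N A)) * (Y : Matrix N N A)) = _
      rw [add_mul, map_add])
    (fun c X Y => by
      change matTrace tr ((c • (X : Matrix N N A)) * (Y : Matrix N N A)) = _
      rw [smul_mul_assoc, map_smul, smul_eq_mul])
    (fun X Y Y' => by
      change matTrace tr ((X : Matrix N N A) * ((Y : Matrix N N A) + (Y' : Matrix N N A))) = _
      rw [mul_add, map_add])
    (fun c X Y => by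
      change matTrace tr ((X : Matrix N N A) * (c • (Y : Matrix N N A))) = _
      rw [mul_smul_comm, map_smul, smul_eq_mul])

/-- `trForm tr X Y = τ(XY)`. [folklore] -/
@[simp] theorem trForm_apply (tr : A →ₗ[ℝ] ℝ) (X Y : H.lie) :
    trForm tr X Y = matTrace tr ((X : Matrix N N A) * (Y : Matrix N N A)) := rfl

/-- The **Cartan-twisted trace form** `B_θ(X, Y) = τ(X Y*)` on `𝔤 = H.lie` (the involution of the
coefficient algebra being `ℝ`-linear). Knapp 2002, VI.§2 (`B_θ(X, Y) = -B(X, θY)`, `θY = -Y*`).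
[folklore] -/
def thetaForm [StarModule ℝ A] (tr : A →ₗ[ℝ] ℝ) : LinearMap.BilinForm ℝ H.lie :=
  LinearMap.mk₂ ℝ (fun X Y : H.lie => matTrace tr ((X : Matrix N N A) * star (Y : Matrix N N A)))
    (fun X X' Y => by
      change matTrace tr (((X : Matrix N N A) + (X' : Matrix N N A)) * star (Y : Matrix N N A)) = _
      rw [add_mul, map_add])
    (fun c X Y => by
      change matTrace tr ((c • (X : Matrix N N A)) * star (Y : Matrix N N A)) = _
      rw [smul_mul_assoc, map_smul, smul_eq_mul])
    (fun X Y Y' => by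
      change matTrace tr ((X : Matrix N N A) * star ((Y : Matrix N N A) + (Y' : Matrix N N A))) = _
      rw [star_add, mul_add, map_add])
    (fun c X Y => by
      change matTrace tr ((X : Matrix N N A) * star (c • (Y : Matrix N N A))) = _
      rw [star_smul, star_trivial, mul_smul_comm, map_smul, smul_eq_mul])

/-- `thetaForm tr X Y = τ(X Y*)`. [folklore] -/
@[simp] theorem thetaForm_apply [StarModule ℝ A] (tr : A →ₗ[ℝ] ℝ) (X Y : H.lie) :
    thetaForm tr X Y = matTrace tr ((X : Matrix N N A) * star (Y : Matrix N N A)) := rfl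

/-- The trace form is symmetric. [folklore] -/
theorem trForm_isSymm (tr : A →ₗ[ℝ] ℝ) : (trForm (H := H) tr).IsSymm :=
  LinearMap.BilinForm.isSymm_def.2 fun X Y => by
    rw [trForm_apply, trForm_apply, matTrace_mul_comm]

/-- The trace form is invariant: `B(⁅X, Y⁆, Z) = -B(Y, ⁅X, Z⁆)`. Knapp 2002, I.§8, Prop. 1.? (the
trace form of a linear Lie algebra is invariant). [folklore] -/
theorem trForm_lieInvariant (tr : A →ₗ[ℝ] ℝ) : (trForm (H := H) tr).lieInvariant H.lie := by
  intro X Y Z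
  rw [trForm_apply, trForm_apply, LieSubalgebra.coe_bracket, LieSubalgebra.coe_bracket,
    Ring.lie_def, Ring.lie_def, sub_mul, mul_sub, map_sub, map_sub]
  have h1 : matTrace tr ((X : Matrix N N A) * (Y : Matrix N N A) * (Z : Matrix N N A)) =
      matTrace tr ((Y : Matrix N N A) * ((Z : Matrix N N A) * (X : Matrix N N A))) := by
    rw [mul_assoc, matTrace_mul_comm, mul_assoc]
  rw [h1, mul_assoc]
  ring

/-- The twisted form is symmetric (for a star-invariant `tr`). [folklore] -/
theorem thetaForm_isSymm [StarModule ℝ A] {tr : A →ₗ[ℝ] ℝ} (htr : ∀ a, tr (star a) = tr a) :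
    (thetaForm (H := H) tr).IsSymm :=
  LinearMap.BilinForm.isSymm_def.2 fun X Y => by
    rw [thetaForm_apply, thetaForm_apply, ← matTrace_conjTranspose htr
      ((Y : Matrix N N A) * star (X : Matrix N N A))]
    congr 1
    rw [Matrix.star_eq_conjTranspose, Matrix.star_eq_conjTranspose, Matrix.conjTranspose_mul,
      Matrix.conjTranspose_conjTranspose]

/-- The twisted form is positive definite (for a positive `tr`). Knapp 2002, VI.§2. [folklore] -/
theorem thetaForm_pos [StarModule ℝ A] {tr : A →ₗ[ℝ] ℝ}
    (hpos : ∀ a : A, a ≠ 0 → 0 < tr (star a * a)) {X : H.lie} (hX : X ≠ 0) :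
    0 < thetaForm tr X X := by
  rw [thetaForm_apply, Matrix.star_eq_conjTranspose]
  exact matTrace_mul_conjTranspose_self_pos hpos fun h => hX (Subtype.ext h)

/-- On a skew-hermitian second argument the trace form is `-B_θ`. [folklore] -/
theorem trForm_eq_neg_thetaForm [StarModule ℝ A] (tr : A →ₗ[ℝ] ℝ) (X : H.lie) {Y : H.lie}
    (hY : star (Y : Matrix N N A) = -(Y : Matrix N N A)) : trForm tr X Y = -thetaForm tr X Y := by
  rw [trForm_apply, thetaForm_apply, hY, mul_neg, map_neg, neg_neg]

/-- On a hermitian second argument the trace form is `B_θ`. [folklore] -/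
theorem trForm_eq_thetaForm [StarModule ℝ A] (tr : A →ₗ[ℝ] ℝ) (X : H.lie) {Y : H.lie}
    (hY : star (Y : Matrix N N A) = (Y : Matrix N N A)) : trForm tr X Y = thetaForm tr X Y := by
  rw [trForm_apply, thetaForm_apply, hY]

/-- The trace form is non-degenerate when `𝔤` is stable under the conjugate transpose and `tr`
is positive. Knapp 2002, VI.§1–2 (a real Lie algebra of matrices closed under conjugate transpose
is reductive; its trace form is non-degenerate). [folklore] -/
theorem trForm_nondegenerate [StarModule ℝ A] {tr : A →ₗ[ℝ] ℝ}
    (hpos : ∀ a : A, a ≠ 0 → 0 < tr (star a * a))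
    (hstar : ∀ X : H.lie, star (X : Matrix N N A) ∈ H.lie) : (trForm (H := H) tr).Nondegenerate := by
  refine (trForm_isSymm (H := H) tr).isRefl.nondegenerate_iff_separatingLeft.2 fun X hX => ?_
  by_contra hne
  have h := hX ⟨star (X : Matrix N N A), hstar X⟩
  rw [trForm_apply] at h
  have hp := thetaForm_pos (H := H) (tr := tr) hpos hne
  rw [thetaForm_apply] at hp
  exact hp.ne' h

end Forms

/-! ### §2 An adapted orthonormal basis; the Casimir element and Nelson's identity -/

section Adapted

/-- A symmetric positive definite bilinear form on a finite-dimensional real vector space has an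
orthonormal basis (orthogonal basis of Mathlib, rescaled). [folklore] -/
theorem exists_basis_orthonormal {V : Type*} [AddCommGroup V] [Module ℝ V] [FiniteDimensional ℝ V]
    (B : LinearMap.BilinForm ℝ V) (hs : B.IsSymm) (hpos : ∀ v, v ≠ 0 → 0 < B v v) :
    ∃ b : Module.Basis (Fin (Module.finrank ℝ V)) ℝ V, ∀ i j, B (b i) (b j) = if i = j then 1 else 0 := by
  haveI : Invertible (2 : ℝ) := invertibleOfNonzero two_ne_zero
  obtain ⟨v, hv⟩ := LinearMap.BilinForm.exists_orthogonal_basis (LinearMap.BilinForm.isSymm_iff.1 hs)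
  have hvpos : ∀ i, 0 < B (v i) (v i) := fun i => hpos _ (v.ne_zero i)
  have hw0 : ∀ i, (Real.sqrt (B (v i) (v i)))⁻¹ ≠ 0 := fun i =>
    inv_ne_zero (Real.sqrt_pos.2 (hvpos i)).ne'
  let w : Fin (Module.finrank ℝ V) → ℝˣ := fun i => Units.mk0 _ (hw0 i)
  refine ⟨v.unitsSMul w, fun i j => ?_⟩
  rw [Module.Basis.unitsSMul_apply, Module.Basis.unitsSMul_apply, Units.smul_def, Units.smul_def,
    LinearMap.BilinForm.smul_left, LinearMap.BilinForm.smul_right]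
  change (Real.sqrt (B (v i) (v i)))⁻¹ * ((Real.sqrt (B (v j) (v j)))⁻¹ * B (v i) (v j)) = _
  split_ifs with hij
  · subst hij
    have hsq : Real.sqrt (B (v i) (v i)) ^ 2 = B (v i) (v i) := Real.sq_sqrt (hvpos i).le
    have hne : Real.sqrt (B (v i) (v i)) ≠ 0 := (Real.sqrt_pos.2 (hvpos i)).ne'
    rw [← mul_assoc, ← mul_inv, ← sq, hsq, inv_mul_cancel₀ (hvpos i).ne']
  · rw [LinearMap.isOrthoᵢ_def.1 hv i j hij, mul_zero, mul_zero]

variable {A : Type*} [NormedCommRing A] [NormedAlgebra ℝ A] [NormedAlgebra ℚ A] [CompleteSpace A]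
  [StarRing A] [StarModule ℝ A] {N : Type*} [Fintype N] [DecidableEq N] {H : RealMatrixGroup A N}

/-- **A `B_θ`-orthonormal basis of `𝔤` adapted to `𝔤 = 𝔨 ⊕ 𝔭`**: when `𝔤` is stable under the
conjugate transpose (and `tr` is a positive star-trace), `𝔤` has a basis indexed by
`Fin n ⊕ Fin m` whose `inl`-vectors are skew-hermitian, whose `inr`-vectors are hermitian, and
which is orthonormal for `B_θ(X, Y) = τ(X Y*)`. Knapp 2002, VI.§2 (Cartan decomposition of a
`θ`-stable linear Lie algebra; `B_θ` is an inner product for which `𝔨 ⊥ 𝔭`).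
[cite: Knapp2002, VI.§2] -/
theorem exists_adaptedBasis [FiniteDimensional ℝ A] {tr : A →ₗ[ℝ] ℝ}
    (htr : ∀ a, tr (star a) = tr a) (hpos : ∀ a : A, a ≠ 0 → 0 < tr (star a * a))
    (hstar : ∀ X : H.lie, star (X : Matrix N N A) ∈ H.lie) :
    ∃ (n m : ℕ) (c : Module.Basis (Fin n ⊕ Fin m) ℝ H.lie),
      (∀ i, star ((c (Sum.inl i) : H.lie) : Matrix N N A) = -((c (Sum.inl i) : H.lie) : Matrix N N A)) ∧
      (∀ j, star ((c (Sum.inr j) : H.lie) : Matrix N N A) = ((c (Sum.inr j) : H.lie) : Matrix N N A)) ∧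
      ∀ s s', thetaForm tr (c s) (c s') = if s = s' then 1 else 0 := by
  -- the involution `σ X = X*` on `𝔤`, an `ℝ`-linear map
  let σ : H.lie →ₗ[ℝ] H.lie :=
    { toFun := fun X => ⟨star (X : Matrix N N A), hstar X⟩
      map_add' := fun X Y => Subtype.ext (by
        change star ((X : Matrix N N A) + (Y : Matrix N N A)) = star (X : Matrix N N A) + star (Y : Matrix N N A)
        exact star_add _ _)
      map_smul' := fun r X => Subtype.ext (by
        change star (r • (X : Matrix N N A)) = r • star (X : Matrix N N A)
        rw [star_smul, star_trivial]) }
  have hσ : ∀ X : H.lie, ((σ X : H.lie) : Matrix N N A) = star (X : Matrix N N A) := fun X => rfl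
  have hσσ : ∀ X : H.lie, σ (σ X) = X := fun X => Subtype.ext (by rw [hσ, hσ, star_star])
  -- `𝔨` and `𝔭` as submodules
  let K : Submodule ℝ H.lie := LinearMap.ker (σ + LinearMap.id)
  let P : Submodule ℝ H.lie := LinearMap.ker (σ - LinearMap.id)
  have hK : ∀ X : H.lie, X ∈ K ↔ star (X : Matrix N N A) = -(X : Matrix N N A) := fun X => by
    change σ X + X = 0 ↔ _
    rw [add_eq_zero_iff_eq_neg, ← hσ]
    exact ⟨fun h => congrArg Subtype.val h, fun h => Subtype.ext h⟩
  have hP : ∀ X : H.lie, X ∈ P ↔ star (X : Matrix N N A) = (X : Matrix N N A) := fun X => by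
    change σ X - X = 0 ↔ _
    rw [sub_eq_zero, ← hσ]
    exact ⟨fun h => congrArg Subtype.val h, fun h => Subtype.ext h⟩
  have hKP : IsCompl K P := by
    refine IsCompl.of_eq ?_ ?_
    · rw [Submodule.eq_bot_iff]
      intro X hX
      have h1 : star (X : Matrix N N A) = -(X : Matrix N N A) := (hK X).1 hX.1
      have h2 : star (X : Matrix N N A) = (X : Matrix N N A) := (hP X).1 hX.2
      have h3 : (2 : ℝ) • (X : Matrix N N A) = 0 := by
        rw [two_smul]
        nth_rewrite 1 [← h2]
        rw [h1, neg_add_cancel]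
      exact Subtype.ext ((smul_eq_zero.1 h3).resolve_left two_ne_zero)
    · rw [Submodule.eq_top_iff']
      intro X
      have hk : (1 / 2 : ℝ) • (X - σ X) ∈ K := by
        rw [hK]
        change star ((1 / 2 : ℝ) • ((X : Matrix N N A) - star (X : Matrix N N A))) =
          -((1 / 2 : ℝ) • ((X : Matrix N N A) - star (X : Matrix N N A)))
        rw [star_smul, star_trivial, star_sub, star_star, ← smul_neg, neg_sub]
      have hp : (1 / 2 : ℝ) • (X + σ X) ∈ P := by
        rw [hP]
        change star ((1 / 2 : ℝ) • ((X : Matrix N N A) + star (X : Matrix N N A))) =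
          (1 / 2 : ℝ) • ((X : Matrix N N A) + star (X : Matrix N N A))
        rw [star_smul, star_trivial, star_add, star_star, add_comm]
      have hX : X = (1 / 2 : ℝ) • (X - σ X) + (1 / 2 : ℝ) • (X + σ X) := by
        rw [← smul_add, sub_add_add_cancel, ← two_smul ℝ X, smul_smul]
        norm_num
      rw [hX]
      exact Submodule.add_mem_sup hk hp
  -- orthonormal bases of `𝔨` and `𝔭` for the restrictions of `B_θ`
  have hθs : (thetaForm (H := H) tr).IsSymm := thetaForm_isSymm htr
  have hres : ∀ W : Submodule ℝ H.lie, ((thetaForm (H := H) tr).restrict W).IsSymm ∧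
      ∀ v : W, v ≠ 0 → 0 < (thetaForm (H := H) tr).restrict W v v := fun W =>
    ⟨LinearMap.BilinForm.isSymm_def.2 fun x y => by
      rw [LinearMap.BilinForm.restrict_apply, LinearMap.BilinForm.restrict_apply]
      exact LinearMap.BilinForm.isSymm_def.1 hθs _ _,
     fun v hv => by
      rw [LinearMap.BilinForm.restrict_apply]
      exact thetaForm_pos hpos fun h => hv (Subtype.ext h)⟩
  obtain ⟨bK, hbK⟩ := exists_basis_orthonormal _ (hres K).1 (hres K).2
  obtain ⟨bP, hbP⟩ := exists_basis_orthonormal _ (hres P).1 (hres P).2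
  -- the combined basis
  let c : Module.Basis (Fin (Module.finrank ℝ K) ⊕ Fin (Module.finrank ℝ P)) ℝ H.lie :=
    (bK.prod bP).map (Submodule.prodEquivOfIsCompl K P hKP)
  have hcl : ∀ i, c (Sum.inl i) = (bK i : H.lie) := fun i => by
    change Submodule.prodEquivOfIsCompl K P hKP (bK.prod bP (Sum.inl i)) = _
    rw [Submodule.coe_prodEquivOfIsCompl', Module.Basis.prod_apply_inl_fst,
      Module.Basis.prod_apply_inl_snd, ZeroMemClass.coe_zero, add_zero]
  have hcr : ∀ j, c (Sum.inr j) = (bP j : H.lie) := fun j => by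
    change Submodule.prodEquivOfIsCompl K P hKP (bK.prod bP (Sum.inr j)) = _
    rw [Submodule.coe_prodEquivOfIsCompl', Module.Basis.prod_apply_inr_fst,
      Module.Basis.prod_apply_inr_snd, ZeroMemClass.coe_zero, zero_add]
  have hskew : ∀ i, star ((c (Sum.inl i) : H.lie) : Matrix N N A) = -((c (Sum.inl i) : H.lie) : Matrix N N A) :=
    fun i => by rw [hcl]; exact (hK _).1 (bK i).2
  have hherm : ∀ j, star ((c (Sum.inr j) : H.lie) : Matrix N N A) = ((c (Sum.inr j) : H.lie) : Matrix N N A) :=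
    fun j => by rw [hcr]; exact (hP _).1 (bP j).2
  -- `𝔨 ⊥ 𝔭` for `B_θ`
  have hcross : ∀ {Y X : H.lie}, star (Y : Matrix N N A) = -(Y : Matrix N N A) →
      star (X : Matrix N N A) = (X : Matrix N N A) → thetaForm tr Y X = 0 := by
    intro Y X hY hX
    have h1 : thetaForm tr Y X = matTrace tr ((Y : Matrix N N A) * (X : Matrix N N A)) := by
      rw [thetaForm_apply, hX]
    have h2 : thetaForm tr X Y = -matTrace tr ((Y : Matrix N N A) * (X : Matrix N N A)) := by
      rw [thetaForm_apply, hY, mul_neg, map_neg, matTrace_mul_comm]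
    have h3 := LinearMap.BilinForm.isSymm_def.1 hθs Y X
    linarith
  refine ⟨_, _, c, hskew, hherm, fun s s' => ?_⟩
  rcases s with i | j <;> rcases s' with i' | j'
  · rw [hcl, hcl]
    have := hbK i i'
    rw [LinearMap.BilinForm.restrict_apply, LinearMap.domRestrict_apply] at this
    rw [this]
    by_cases h : i = i' <;> simp [h]
  · rw [hcross (hskew i) (hherm j')]
    simp
  · rw [LinearMap.BilinForm.isSymm_def.1 hθs, hcross (hskew i') (hherm j)]
    simp
  · rw [hcr, hcr]
    have := hbP j j'
    rw [LinearMap.BilinForm.restrict_apply, LinearMap.domRestrict_apply] at this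
    rw [this]
    by_cases h : j = j' <;> simp [h]

/-- **The `B`-dual of an adapted `B_θ`-orthonormal basis is `∓` itself**: for the real trace form
`B` on a conjugate-transpose-stable `𝔤` and a basis `c` as in `exists_adaptedBasis`,
`B.dualBasis c (inl i) = -c (inl i)` and `B.dualBasis c (inr j) = c (inr j)` (`B = -B_θ` against
`𝔨`, `B = B_θ` against `𝔭`). Knapp 2002, VI.§2. [folklore] -/
theorem dualBasis_adapted {tr : A →ₗ[ℝ] ℝ} (hB : (trForm (H := H) tr).Nondegenerate)
    {n m : ℕ} (c : Module.Basis (Fin n ⊕ Fin m) ℝ H.lie)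
    (hskew : ∀ i, star ((c (Sum.inl i) : H.lie) : Matrix N N A) = -((c (Sum.inl i) : H.lie) : Matrix N N A))
    (hherm : ∀ j, star ((c (Sum.inr j) : H.lie) : Matrix N N A) = ((c (Sum.inr j) : H.lie) : Matrix N N A))
    (horth : ∀ s s', thetaForm tr (c s) (c s') = if s = s' then 1 else 0) :
    (∀ i, (trForm tr).dualBasis hB c (Sum.inl i) = -c (Sum.inl i)) ∧
      ∀ j, (trForm tr).dualBasis hB c (Sum.inr j) = c (Sum.inr j) := by
  -- the candidate dual family
  let dd : Fin n ⊕ Fin m → H.lie := fun s => Sum.elim (fun i => -c (Sum.inl i)) (fun j => c (Sum.inr j)) s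
  -- it pairs with `c` like the dual basis
  have hpair : ∀ s s', trForm tr (dd s) (c s') = if s' = s then 1 else 0 := by
    intro s s'
    rcases s with i | j <;> rcases s' with i' | j'
    · change trForm tr (-c (Sum.inl i)) (c (Sum.inl i')) = _
      rw [LinearMap.BilinForm.neg_left, trForm_eq_neg_thetaForm tr _ (hskew i'), neg_neg, horth]
      by_cases h : i = i' <;> simp [h, eq_comm]
    · change trForm tr (-c (Sum.inl i)) (c (Sum.inr j')) = _
      rw [LinearMap.BilinForm.neg_left, trForm_eq_thetaForm tr _ (hherm j'), horth]
      simp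
    · change trForm tr (c (Sum.inr j)) (c (Sum.inl i')) = _
      rw [trForm_eq_neg_thetaForm tr _ (hskew i'), horth]
      simp
    · change trForm tr (c (Sum.inr j)) (c (Sum.inr j')) = _
      rw [trForm_eq_thetaForm tr _ (hherm j'), horth]
      by_cases h : j = j' <;> simp [h, eq_comm]
  -- uniqueness from non-degeneracy
  have huniq : ∀ s, (trForm tr).dualBasis hB c s = dd s := by
    intro s
    have hzero : (trForm tr) ((trForm tr).dualBasis hB c s - dd s) = 0 := by
      refine c.ext fun s' => ?_
      rw [LinearMap.BilinForm.sub_left, LinearMap.BilinForm.apply_dualBasis_left, hpair,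
        sub_self, LinearMap.zero_apply]
    have h := hB.1 ((trForm tr).dualBasis hB c s - dd s) fun y => by
      rw [hzero, LinearMap.zero_apply]
    exact sub_eq_zero.1 h
  exact ⟨fun i => huniq (Sum.inl i), fun j => huniq (Sum.inr j)⟩

/-- **Nelson's identity `∑ₗ cₗ² = Ω + 2 ∑_𝔨 Yᵢ²` in `U(𝔤)`.** For the real trace form `B` on a
conjugate-transpose-stable `𝔤` and an adapted `B_θ`-orthonormal basis `c` (`exists_adaptedBasis`),
the Casimir element of `B` is `Ω = -∑ᵢ Y_i² + ∑ⱼ X_j²` (`Yᵢ = c (inl i) ∈ 𝔨`, `Xⱼ = c (inr j) ∈ 𝔭`),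
so that the sum of squares over the whole basis is `Ω + 2 ∑ᵢ Yᵢ²`; `Ω` is central in `U(𝔤)`
(`Literature.Algebra.Lie.casimirElement_mem_center`). Harish-Chandra 1953, §11; Nelson 1959, §8;
Knapp 2002, Prop. 5.24 and VIII.§3 (`Ω = -∑ Yᵢ² + ∑ Xⱼ²`). [cite: HarishChandraTAMS1953, §11] -/
theorem sum_sq_eq_casimir_add {tr : A →ₗ[ℝ] ℝ} (hB : (trForm (H := H) tr).Nondegenerate)
    {n m : ℕ} (c : Module.Basis (Fin n ⊕ Fin m) ℝ H.lie)
    (hskew : ∀ i, star ((c (Sum.inl i) : H.lie) : Matrix N N A) = -((c (Sum.inl i) : H.lie) : Matrix N N A))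
    (hherm : ∀ j, star ((c (Sum.inr j) : H.lie) : Matrix N N A) = ((c (Sum.inr j) : H.lie) : Matrix N N A))
    (horth : ∀ s s', thetaForm tr (c s) (c s') = if s = s' then 1 else 0) :
    (∑ s, ι ℝ (c s) * ι ℝ (c s) : UniversalEnvelopingAlgebra ℝ H.lie) =
      Literature.Algebra.Lie.casimirElement (trForm tr) hB c +
        (2 : ℝ) • ∑ i, ι ℝ (c (Sum.inl i)) * ι ℝ (c (Sum.inl i)) := by
  obtain ⟨hl, hr⟩ := dualBasis_adapted hB c hskew hherm horth
  unfold Literature.Algebra.Lie.casimirElement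
  rw [Fintype.sum_sum_type, Fintype.sum_sum_type]
  simp only [hl, hr, map_neg, mul_neg, Finset.sum_neg_distrib, two_smul]
  abel

end Adapted


/-! ### §3 The annihilator -/

section WordAction

variable {A : Type*} [NormedCommRing A] [NormedAlgebra ℝ A] [NormedAlgebra ℚ A] [CompleteSpace A]
  [StarRing A] {N : Type*} [Fintype N] [DecidableEq N] {H : RealMatrixGroup A N}
  {G : Type*} [Group G] (ι : H.carrier →* G)

/-- The sum-of-squares operator of a finite family `c` in `𝔤`: `L_c ψ = ∑ₗ cₗ (cₗ ψ)`.
Nelson 1959, §8 (`Δ = ∑ Xᵢ²`). [folklore] -/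
def sqSumOp {κ : Type*} [Fintype κ] (c : κ → H.lie) (ψ : G → ℂ) : G → ℂ :=
  ∑ l, iterLieDeriv ι [c l, c l] ψ

/-- Unfolding `sqSumOp`. [folklore] -/
theorem sqSumOp_apply {κ : Type*} [Fintype κ] (c : κ → H.lie) (ψ : G → ℂ) (x : G) :
    sqSumOp ι c ψ x = ∑ l, lieDeriv ι (c l) (lieDeriv ι (c l) ψ) x := by
  unfold sqSumOp
  rw [Finset.sum_apply]
  rfl

/-- The word `ι X · ι X` acts as `ψ ↦ X (X ψ)` (no smoothness needed). [folklore] -/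
theorem applyFree_ι_mul_ι (X : H.lie) (ψ : G → ℂ) :
    applyFree ι (FreeAlgebra.ι ℝ X * FreeAlgebra.ι ℝ X) ψ = iterLieDeriv ι [X, X] ψ := by
  have hmul : FreeAlgebra.ι ℝ X * FreeAlgebra.ι ℝ X =
      FreeAlgebra.basisFreeMonoid ℝ H.lie (FreeMonoid.of X * FreeMonoid.of X) := by
    rw [basisFreeMonoid_eq_lift, map_mul, FreeMonoid.lift_eval_of]
  rw [hmul, applyFree_basisFreeMonoid, FreeMonoid.toList_mul, FreeMonoid.toList_of]
  rfl

/-- **The word `∑ₗ ι cₗ · ι cₗ` acts as the sum-of-squares operator `L_c`** (no smoothness needed).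
[folklore] -/
theorem applyFree_sum_ι_mul_ι {κ : Type*} [Fintype κ] (c : κ → H.lie) (ψ : G → ℂ) :
    applyFree ι (∑ l, FreeAlgebra.ι ℝ (c l) * FreeAlgebra.ι ℝ (c l)) ψ = sqSumOp ι c ψ := by
  classical
  unfold sqSumOp
  have h0 : applyFree ι (0 : FreeAlgebra ℝ H.lie) ψ = 0 := by
    have h := applyFree_smul_left ι 0 (1 : FreeAlgebra ℝ H.lie) ψ
    rwa [zero_smul, Complex.ofReal_zero, zero_smul] at h
  induction (Finset.univ : Finset κ) using Finset.induction_on with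
  | empty => rw [Finset.sum_empty, Finset.sum_empty, h0]
  | insert l s hl ih => rw [Finset.sum_insert hl, Finset.sum_insert hl, applyFree_add, ih,
      applyFree_ι_mul_ι]

/-- `sqSumOp` is homogeneous (no smoothness needed). [folklore] -/
theorem sqSumOp_smul {κ : Type*} [Fintype κ] (c : κ → H.lie) (a : ℂ) (ψ : G → ℂ) :
    sqSumOp ι c (a • ψ) = a • sqSumOp ι c ψ := by
  rw [← applyFree_sum_ι_mul_ι, ← applyFree_sum_ι_mul_ι, applyFree_smul_right]

/-- The identity map `𝔤 → 𝔤` between the Lie subalgebra and its underlying submodule, as a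
linear equivalence (same carrier). [folklore] -/
def lieEquivSubmodule (H : RealMatrixGroup A N) : H.lie ≃ₗ[ℝ] H.lie.toSubmodule where
  toFun X := ⟨X, X.2⟩
  invFun X := ⟨X, X.2⟩
  map_add' _ _ := rfl
  map_smul' _ _ := rfl
  left_inv _ := rfl
  right_inv _ := rfl

/-- `lieEquivSubmodule` does not change the matrix. [folklore] -/
@[simp] theorem coe_lieEquivSubmodule (H : RealMatrixGroup A N) (X : H.lie) :
    ((lieEquivSubmodule H X : H.lie.toSubmodule) : Matrix N N A) = X := rfl

/-! #### The finite-dimensional space `V = Z(𝔤) · (K-span of φ)` -/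

/-- The space `V(φ) = span {z ψ : z a central word, ψ in the K-span of φ}`: the
`Z(𝔤) U(𝔨)`-module generated by a `K`-finite `Z(𝔤)`-finite smooth `φ`.
Borel 1972, 3.15–3.16; Harish-Chandra 1966, §8. [folklore] -/
def zkSpan (φ : G → ℂ) : Submodule ℂ (G → ℂ) :=
  Submodule.span ℂ {u | ∃ p : FreeAlgebra ℝ H.lie, IsCentralWord p ∧
    ∃ ψ ∈ kTranslateSpan ι φ, u = applyFree ι p ψ}

/-- The `K`-span lies in `V(φ)`. [folklore] -/
theorem kTranslateSpan_le_zkSpan (φ : G → ℂ) : kTranslateSpan ι φ ≤ zkSpan ι φ := fun ψ hψ =>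
  Submodule.subset_span ⟨1, isCentralWord_one, ψ, hψ, (applyFree_one ι ψ).symm⟩

/-- `φ ∈ V(φ)`. [folklore] -/
theorem mem_zkSpan_self (φ : G → ℂ) : φ ∈ zkSpan ι φ :=
  kTranslateSpan_le_zkSpan ι φ (mem_kTranslateSpan_self ι φ)

variable [FiniteDimensional ℝ A]

/-- **The word action is multiplicative on smooth functions**: `(p · q) ψ = p (q ψ)` for smooth `ψ`
(it is the action of `U(𝔤)` through the algebra homomorphism `envelopingAction`).
Borel–Jacquet 1979, §1.5–1.6; Dixmier, 2.1.1. [cite: BorelJacquetCorvallis1979, §1.5] -/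
theorem IsArchSmooth.applyFree_mul (p q : FreeAlgebra ℝ H.lie) {ψ : G → ℂ}
    (hψ : IsArchSmooth ι ψ) : applyFree ι (p * q) ψ = applyFree ι p (applyFree ι q ψ) := by
  obtain ⟨ρ, hρ⟩ := exists_lieHom_lieDeriv ι
  have hq := coe_envelopingAction_freeToEnveloping_of_forall_eq ρ hρ q ⟨ψ, hψ⟩
  have hsm : IsArchSmooth ι (applyFree ι q ψ) := isArchSmooth_applyFree_of_isArchSmooth q hψ
  have hq' : (envelopingAction ρ (freeToEnveloping H q)) ⟨ψ, hψ⟩ =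
      (⟨applyFree ι q ψ, hsm⟩ : archSmooth ι) := Subtype.ext hq
  rw [← coe_envelopingAction_freeToEnveloping_of_forall_eq ρ hρ (p * q) ⟨ψ, hψ⟩,
    ← coe_envelopingAction_freeToEnveloping_of_forall_eq ρ hρ p ⟨_, hsm⟩, map_mul, map_mul,
    Module.End.mul_apply, hq']

/-- `sqSumOp` is additive on smooth functions. [folklore] -/
theorem sqSumOp_add {κ : Type*} [Fintype κ] (c : κ → H.lie) {ψ₁ ψ₂ : G → ℂ}
    (h₁ : IsArchSmooth ι ψ₁) (h₂ : IsArchSmooth ι ψ₂) :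
    sqSumOp ι c (ψ₁ + ψ₂) = sqSumOp ι c ψ₁ + sqSumOp ι c ψ₂ := by
  rw [← applyFree_sum_ι_mul_ι, ← applyFree_sum_ι_mul_ι, ← applyFree_sum_ι_mul_ι,
    applyFree_add_right_of_isArchSmooth_lieDeriv ι isArchSmooth_lieDeriv_holds _ h₁ h₂]

/-- `sqSumOp` preserves smoothness. [folklore] -/
theorem isArchSmooth_sqSumOp {κ : Type*} [Fintype κ] (c : κ → H.lie) {ψ : G → ℂ}
    (hψ : IsArchSmooth ι ψ) : IsArchSmooth ι (sqSumOp ι c ψ) := by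
  rw [← applyFree_sum_ι_mul_ι]
  exact isArchSmooth_applyFree_of_isArchSmooth _ hψ

/-- **Central words preserve the `Z(𝔤)`-orbit span of a smooth function**: `z (z' φ) = (z z') φ`.
Borel–Jacquet 1979, §1.6. [cite: BorelJacquetCorvallis1979, §1.6] -/
theorem applyFree_mem_zOrbitSpan_of_isCentralWord {p : FreeAlgebra ℝ H.lie} (hp : IsCentralWord p)
    {φ : G → ℂ} (hφ : IsArchSmooth ι φ) {ψ : G → ℂ} (hψ : ψ ∈ zOrbitSpan ι φ) :
    applyFree ι p ψ ∈ zOrbitSpan ι φ := by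
  induction hψ using Submodule.span_induction with
  | mem ψ h =>
    obtain ⟨q, hq, rfl⟩ := h
    rw [← IsArchSmooth.applyFree_mul ι p q hφ]
    exact Submodule.subset_span ⟨_, hp.mul hq, rfl⟩
  | zero => rw [applyFree_zero_right]; exact zero_mem _
  | add ψ₁ ψ₂ hψ₁ hψ₂ ih₁ ih₂ =>
    rw [applyFree_add_right_of_isArchSmooth_lieDeriv ι isArchSmooth_lieDeriv_holds p
      (isArchSmooth_of_mem_zOrbitSpan ι hφ hψ₁) (isArchSmooth_of_mem_zOrbitSpan ι hφ hψ₂)]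
    exact add_mem ih₁ ih₂
  | smul a ψ _ ih => rw [applyFree_smul_right]; exact Submodule.smul_mem _ a ih

/-- The span of the `K`-translates of a smooth function consists of smooth functions. [folklore] -/
theorem kTranslateSpan_le_archSmooth {φ : G → ℂ} (hφ : IsArchSmooth ι φ) :
    kTranslateSpan ι φ ≤ archSmooth ι := by
  refine Submodule.span_le.2 ?_
  rintro _ ⟨k, rfl⟩
  exact isArchSmooth_archTranslate ι _ hφ

/-- The span of the `K`-translates of a `Z(𝔤)`-finite smooth function consists of `Z(𝔤)`-finite
functions. Borel–Jacquet 1979, §1.6. [folklore] -/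
theorem isZFinite_of_mem_kTranslateSpan {φ : G → ℂ} (hφ : IsArchSmooth ι φ) (hZ : IsZFinite ι φ)
    {ψ : G → ℂ} (hψ : ψ ∈ kTranslateSpan ι φ) : IsZFinite ι ψ := by
  induction hψ using Submodule.span_induction with
  | mem ψ h =>
    obtain ⟨k, rfl⟩ := h
    exact isZFinite_archTranslate ι _ hZ
  | zero => exact isZFinite_zero ι
  | add ψ₁ ψ₂ hψ₁ hψ₂ ih₁ ih₂ =>
    exact IsZFinite.add_of_isArchSmooth_lieDeriv ι isArchSmooth_lieDeriv_holds
      (kTranslateSpan_le_archSmooth ι hφ hψ₁) (kTranslateSpan_le_archSmooth ι hφ hψ₂) ih₁ ih₂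
  | smul a ψ _ ih => exact ih.smul ι a

/-- **`𝔨`-directions preserve the `K`-span** of a smooth `K`-finite function: for `Y` with
`exp(tY) ∈ K` and `ψ` in the span of the `K`-translates of `φ`, `Y ψ` lies in that span
(Borel 1997, 2.16). [cite: Borel1997, 2.16] -/
theorem lieDeriv_mem_kTranslateSpan_of_mem {φ : G → ℂ} (hφ : IsArchSmooth ι φ) (hK : IsKFinite ι φ)
    {Y : H.lie} (hY : ∀ t : ℝ, (H.expMem (t • Y) : GL N A) ∈ H.maximalCompact) {ψ : G → ℂ}
    (hψ : ψ ∈ kTranslateSpan ι φ) : lieDeriv ι Y ψ ∈ kTranslateSpan ι φ := by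
  induction hψ using Submodule.span_induction with
  | mem ψ h =>
    obtain ⟨k, rfl⟩ := h
    have h1 := (isArchSmooth_archTranslate ι _ hφ).lieDeriv_mem_kTranslateSpan
      (isKFinite_translate k hK) hY
    refine (Submodule.span_le.2 ?_) h1
    rintro _ ⟨k', rfl⟩
    exact archTranslate_mem_kTranslateSpan_of_mem ι k' (archTranslate_mem_kTranslateSpan ι k φ)
  | zero => rw [lieDeriv_zero_right]; exact zero_mem _
  | add ψ₁ ψ₂ hψ₁ hψ₂ ih₁ ih₂ =>
    rw [IsArchSmooth.lieDeriv_add ι Y (kTranslateSpan_le_archSmooth ι hφ hψ₁)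
      (kTranslateSpan_le_archSmooth ι hφ hψ₂)]
    exact add_mem ih₁ ih₂
  | smul a ψ _ ih => rw [lieDeriv_smul]; exact Submodule.smul_mem _ a ih

/-- `V(φ)` consists of smooth functions for smooth `φ`. [folklore] -/
theorem zkSpan_le_archSmooth {φ : G → ℂ} (hφ : IsArchSmooth ι φ) : zkSpan ι φ ≤ archSmooth ι := by
  refine Submodule.span_le.2 ?_
  rintro _ ⟨p, -, ψ, hψ, rfl⟩
  exact isArchSmooth_applyFree_of_isArchSmooth p (kTranslateSpan_le_archSmooth ι hφ hψ)

/-- **Central words preserve `V(φ)`.** [folklore] -/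
theorem applyFree_mem_zkSpan_of_isCentralWord {p : FreeAlgebra ℝ H.lie} (hp : IsCentralWord p)
    {φ : G → ℂ} (hφ : IsArchSmooth ι φ) {u : G → ℂ} (hu : u ∈ zkSpan ι φ) :
    applyFree ι p u ∈ zkSpan ι φ := by
  induction hu using Submodule.span_induction with
  | mem u h =>
    obtain ⟨q, hq, ψ, hψ, rfl⟩ := h
    rw [← IsArchSmooth.applyFree_mul ι p q (kTranslateSpan_le_archSmooth ι hφ hψ)]
    exact Submodule.subset_span ⟨_, hp.mul hq, ψ, hψ, rfl⟩
  | zero => rw [applyFree_zero_right]; exact zero_mem _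
  | add u₁ u₂ hu₁ hu₂ ih₁ ih₂ =>
    rw [applyFree_add_right_of_isArchSmooth_lieDeriv ι isArchSmooth_lieDeriv_holds p
      (zkSpan_le_archSmooth ι hφ hu₁) (zkSpan_le_archSmooth ι hφ hu₂)]
    exact add_mem ih₁ ih₂
  | smul a u _ ih => rw [applyFree_smul_right]; exact Submodule.smul_mem _ a ih

/-- **`𝔨`-directions preserve `V(φ)`** (central words commute with Lie derivatives on smooth
functions, and `𝔨` preserves the `K`-span). Borel 1972, 3.16. [folklore] -/
theorem lieDeriv_mem_zkSpan {φ : G → ℂ} (hφ : IsArchSmooth ι φ) (hK : IsKFinite ι φ)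
    {Y : H.lie} (hY : ∀ t : ℝ, (H.expMem (t • Y) : GL N A) ∈ H.maximalCompact) {u : G → ℂ}
    (hu : u ∈ zkSpan ι φ) : lieDeriv ι Y u ∈ zkSpan ι φ := by
  induction hu using Submodule.span_induction with
  | mem u h =>
    obtain ⟨q, hq, ψ, hψ, rfl⟩ := h
    have hψs : IsArchSmooth ι ψ := kTranslateSpan_le_archSmooth ι hφ hψ
    rw [← applyFree_lieDeriv_of_isCentralWord_of_isArchSmooth hq Y hψs]
    have hYψ : lieDeriv ι Y ψ ∈ kTranslateSpan ι φ := lieDeriv_mem_kTranslateSpan_of_mem ι hφ hK hY hψ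
    exact Submodule.subset_span ⟨q, hq, _, hYψ, rfl⟩
  | zero => rw [lieDeriv_zero_right]; exact zero_mem _
  | add u₁ u₂ hu₁ hu₂ ih₁ ih₂ =>
    rw [IsArchSmooth.lieDeriv_add ι Y (zkSpan_le_archSmooth ι hφ hu₁) (zkSpan_le_archSmooth ι hφ hu₂)]
    exact add_mem ih₁ ih₂
  | smul a u _ ih => rw [lieDeriv_smul]; exact Submodule.smul_mem _ a ih

/-- **`V(φ)` is finite-dimensional** for a smooth `K`-finite `Z(𝔤)`-finite `φ`: it lies in the
finite sum of the `Z(𝔤)`-orbit spans of a finite spanning family of the `K`-span, each member of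
which is `Z(𝔤)`-finite (`isZFinite_archTranslate`). Borel 1972, 3.16–3.17. [folklore] -/
theorem finiteDimensional_zkSpan {φ : G → ℂ} (hφ : IsArchSmooth ι φ) (hK : IsKFinite ι φ)
    (hZ : IsZFinite ι φ) : FiniteDimensional ℂ (zkSpan ι φ) := by
  haveI : FiniteDimensional ℂ (kTranslateSpan ι φ) := hK
  obtain ⟨S, hS⟩ : (kTranslateSpan ι φ).FG := Submodule.FG.of_finite
  have hSE : ∀ ψ ∈ S, ψ ∈ kTranslateSpan ι φ := fun ψ hψ => hS ▸ Submodule.subset_span hψ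
  haveI : ∀ i : S, FiniteDimensional ℂ (zOrbitSpan ι (i : G → ℂ)) := fun i =>
    isZFinite_of_mem_kTranslateSpan ι hφ hZ (hSE i i.2)
  set W : Submodule ℂ (G → ℂ) := ⨆ i : S, zOrbitSpan ι (i : G → ℂ) with hW_def
  haveI : FiniteDimensional ℂ W := Submodule.finiteDimensional_iSup _
  refine Submodule.finiteDimensional_of_le (S₂ := W) (Submodule.span_le.2 ?_)
  rintro _ ⟨p, hp, ψ, hψ, rfl⟩
  rw [← hS] at hψ
  change applyFree ι p ψ ∈ W
  induction hψ using Submodule.span_induction with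
  | mem ψ h =>
    have hmem : applyFree ι p ψ ∈ zOrbitSpan ι ψ := Submodule.subset_span ⟨p, hp, rfl⟩
    exact (le_iSup (fun i : S => zOrbitSpan ι (i : G → ℂ)) ⟨ψ, h⟩) hmem
  | zero => rw [applyFree_zero_right]; exact zero_mem _
  | add ψ₁ ψ₂ hψ₁ hψ₂ ih₁ ih₂ =>
    rw [hS] at hψ₁ hψ₂
    rw [applyFree_add_right_of_isArchSmooth_lieDeriv ι isArchSmooth_lieDeriv_holds p
      (kTranslateSpan_le_archSmooth ι hφ hψ₁) (kTranslateSpan_le_archSmooth ι hφ hψ₂)]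
    exact add_mem ih₁ ih₂
  | smul a ψ _ ih => rw [applyFree_smul_right]; exact Submodule.smul_mem _ a ih

end WordAction

section Annihilator

variable {A : Type*} [NormedCommRing A] [NormedAlgebra ℝ A] [NormedAlgebra ℚ A] [CompleteSpace A]
  [StarRing A] [StarModule ℝ A] [ContinuousStar A] {N : Type*} [Fintype N] [DecidableEq N]
  {H : RealMatrixGroup A N} {G : Type*} [Group G] (ι : H.carrier →* G)

/-- **A full Lie algebra is stable under the conjugate transpose**: if every one-parameter
subgroup of `H` is generated by `𝔤` then `X ∈ 𝔤 ⇒ X* ∈ 𝔤` (`exp(tX*) = (exp tX)*` and `H` is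
`*`-stable). Knapp 2002, I.§1 (closed linear groups stable under conjugate transpose). [folklore] -/
theorem star_mem_lie_of_forall_expGL
    (hreg : ∀ X : Matrix N N A, (∀ t : ℝ, expGL (t • X) ∈ H.carrier) → X ∈ H.lie)
    {X : Matrix N N A} (hX : X ∈ H.lie) : star X ∈ H.lie := by
  refine hreg _ fun t => ?_
  have h : expGL (t • star X) = star (expGL (t • X)) := by
    ext : 1
    rw [coe_expGL, Units.coe_star, coe_expGL, NormedSpace.star_exp, star_smul, star_trivial t]
  rw [h]
  exact H.star_mem _ (H.expGL_smul_mem X hX t)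

/-- A skew-hermitian element of `𝔤` exponentiates into `K`. Knapp 2002, I.§10, Prop. 1.87.
[folklore] -/
theorem expMem_smul_mem_maximalCompact {Y : H.lie} (hY : star (Y : Matrix N N A) = -(Y : Matrix N N A))
    (t : ℝ) : (H.expMem (t • Y) : GL N A) ∈ H.maximalCompact := by
  -- Mathlib idiom (Mathlib/Algebra/Lie/OfAssociative.lean), needed to use `𝔨 = compactLie`
  have hmem : (Y : Matrix N N A) ∈ H.compactLie := (H.mem_compactLie_iff _).2 ⟨Y.2, hY⟩
  exact (H.expK ⟨t • (Y : Matrix N N A), H.compactLie.smul_mem t hmem⟩).2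

variable [FiniteDimensional ℝ A]

/-- **The sum of squares over an adapted basis preserves `V(φ)`** (Nelson's identity
`∑ₗ cₗ² = Ω + 2 ∑_𝔨 Yᵢ²` in `U(𝔤)`: the Casimir element acts through a central word, the `Yᵢ ∈ 𝔨`
preserve `V(φ)`). Harish-Chandra 1953, §11; Nelson 1959, §8; Borel 1972, 3.15. [cite: Nelson1959, §8] -/
theorem sqSumOp_mem_zkSpan {tr : A →ₗ[ℝ] ℝ} (hB : (trForm (H := H) tr).Nondegenerate)
    {n m : ℕ} (c : Module.Basis (Fin n ⊕ Fin m) ℝ H.lie)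
    (hskew : ∀ i, star ((c (Sum.inl i) : H.lie) : Matrix N N A) = -((c (Sum.inl i) : H.lie) : Matrix N N A))
    (hherm : ∀ j, star ((c (Sum.inr j) : H.lie) : Matrix N N A) = ((c (Sum.inr j) : H.lie) : Matrix N N A))
    (horth : ∀ s s', thetaForm tr (c s) (c s') = if s = s' then 1 else 0)
    {φ : G → ℂ} (hφ : IsArchSmooth ι φ) (hK : IsKFinite ι φ) {u : G → ℂ} (hu : u ∈ zkSpan ι φ) :
    sqSumOp ι c u ∈ zkSpan ι φ := by
  have hus : IsArchSmooth ι u := zkSpan_le_archSmooth ι hφ hu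
  -- the free lifts of `∑ cₗ²`, of the Casimir element and of `∑_𝔨 Yᵢ²`
  set P : FreeAlgebra ℝ H.lie := ∑ s, FreeAlgebra.ι ℝ (c s) * FreeAlgebra.ι ℝ (c s) with hP
  set pΩ : FreeAlgebra ℝ H.lie :=
    ∑ s, FreeAlgebra.ι ℝ (c s) * FreeAlgebra.ι ℝ ((trForm tr).dualBasis hB c s) with hpΩ
  set pK : FreeAlgebra ℝ H.lie :=
    ∑ i, FreeAlgebra.ι ℝ (c (Sum.inl i)) * FreeAlgebra.ι ℝ (c (Sum.inl i)) with hpK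
  have hΩimg : freeToEnveloping H pΩ = Literature.Algebra.Lie.casimirElement (trForm tr) hB c := by
    rw [hpΩ, map_sum]
    unfold Literature.Algebra.Lie.casimirElement
    refine Finset.sum_congr rfl fun s _ => ?_
    rw [map_mul, freeToEnveloping_ι, freeToEnveloping_ι]
  have hΩcent : IsCentralWord pΩ := by
    unfold IsCentralWord
    rw [hΩimg]
    exact Literature.Algebra.Lie.casimirElement_mem_center (trForm_isSymm tr)
      (trForm_lieInvariant tr) c
  have himg : freeToEnveloping H P = freeToEnveloping H (pΩ + (2 : ℝ) • pK) := by
    rw [map_add, map_smul, hΩimg, hP, hpK, map_sum, map_sum]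
    simp only [map_mul, freeToEnveloping_ι]
    exact sum_sq_eq_casimir_add hB c hskew hherm horth
  rw [← applyFree_sum_ι_mul_ι, ← hP, applyFree_congr_holds (ι := ι) himg hus, applyFree_add,
    applyFree_smul_left, hpK, applyFree_sum_ι_mul_ι]
  refine add_mem (applyFree_mem_zkSpan_of_isCentralWord ι hΩcent hφ hu) (Submodule.smul_mem _ _ ?_)
  unfold sqSumOp
  refine Submodule.sum_mem _ fun i _ => ?_
  rw [iterLieDeriv_cons, iterLieDeriv_cons, iterLieDeriv_nil]
  have hYi := expMem_smul_mem_maximalCompact (hskew i)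
  exact lieDeriv_mem_zkSpan ι hφ hK hYi (lieDeriv_mem_zkSpan ι hφ hK hYi hu)

/-- **Cayley–Hamilton: a complex monic annihilator.** For `φ` smooth, `K`-finite and
`Z(𝔤)`-finite and an adapted basis `c`, the characteristic polynomial `χ` of `L_c = ∑ₗ cₗ²` acting
on the finite-dimensional `L_c`-stable space `V(φ) ∋ φ` satisfies `χ(L_c) φ = 0`.
Borel 1972, 3.15–3.16; Harish-Chandra 1966, §8, Lemma 17. [cite: Borel1972, 3.16] -/
theorem exists_charpoly_sqSumOp_eq_zero {tr : A →ₗ[ℝ] ℝ} (hB : (trForm (H := H) tr).Nondegenerate)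
    {n m : ℕ} (c : Module.Basis (Fin n ⊕ Fin m) ℝ H.lie)
    (hskew : ∀ i, star ((c (Sum.inl i) : H.lie) : Matrix N N A) = -((c (Sum.inl i) : H.lie) : Matrix N N A))
    (hherm : ∀ j, star ((c (Sum.inr j) : H.lie) : Matrix N N A) = ((c (Sum.inr j) : H.lie) : Matrix N N A))
    (horth : ∀ s s', thetaForm tr (c s) (c s') = if s = s' then 1 else 0)
    {φ : G → ℂ} (hφ : IsArchSmooth ι φ) (hK : IsKFinite ι φ) (hZ : IsZFinite ι φ) :
    ∃ χ : Polynomial ℂ, χ.Monic ∧ ∀ q : Polynomial ℂ,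
      ∑ k ∈ Finset.range ((q * χ).natDegree + 1), (q * χ).coeff k • (sqSumOp ι c)^[k] φ = 0 := by
  set V : Submodule ℂ (G → ℂ) := zkSpan ι φ with hV_def
  haveI : FiniteDimensional ℂ V := finiteDimensional_zkSpan ι hφ hK hZ
  have hVs : ∀ ψ : V, IsArchSmooth ι (ψ : G → ℂ) := fun ψ => zkSpan_le_archSmooth ι hφ ψ.2
  -- `L_c` as an endomorphism of `V`
  let T : V →ₗ[ℂ] V :=
    { toFun := fun ψ => ⟨sqSumOp ι c ψ, sqSumOp_mem_zkSpan ι hB c hskew hherm horth hφ hK ψ.2⟩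
      map_add' := fun ψ₁ ψ₂ => Subtype.ext (sqSumOp_add ι c (hVs ψ₁) (hVs ψ₂))
      map_smul' := fun a ψ => Subtype.ext (sqSumOp_smul ι c a (ψ : G → ℂ)) }
  have hT : ∀ (k : ℕ) (ψ : V), (((T ^ k) ψ : V) : G → ℂ) = (sqSumOp ι c)^[k] ψ := by
    intro k
    induction k with
    | zero => intro ψ; simp
    | succ k ih =>
      intro ψ
      rw [pow_succ', Module.End.mul_apply, Function.iterate_succ_apply', ← ih]
      rfl
  have haeval : ∀ q : Polynomial ℂ, ((Polynomial.aeval T q (⟨φ, mem_zkSpan_self ι φ⟩ : V) : V) : G → ℂ) =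
      ∑ k ∈ Finset.range (q.natDegree + 1), q.coeff k • (sqSumOp ι c)^[k] φ := by
    intro q
    rw [Polynomial.aeval_eq_sum_range, LinearMap.sum_apply, Submodule.coe_sum]
    simp only [LinearMap.smul_apply, Submodule.coe_smul, hT]
  refine ⟨T.charpoly, T.charpoly_monic, fun q => ?_⟩
  rw [← haeval, map_mul, Module.End.mul_apply, LinearMap.aeval_self_charpoly]
  simp

/-- **A real monic annihilator `R(L_c) φ = 0`.** With `χ` as above, `R = χ̄ χ` has real coefficients,
is monic, and `R(L_c) φ = 0`: a smooth `K`-finite `Z(𝔤)`-finite function is annihilated by a real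
monic polynomial in the sum of squares `L_c = ∑ₗ cₗ²` over an adapted basis of `𝔤` — an operator
whose expression in exponential coordinates is elliptic. Borel 1972, 3.15–3.16 ("`v` est annulé par
un opérateur elliptique"); Harish-Chandra 1966, §8. [cite: Borel1972, 3.15] -/
theorem exists_real_annihilator_sqSumOp {tr : A →ₗ[ℝ] ℝ} (hB : (trForm (H := H) tr).Nondegenerate)
    {n m : ℕ} (c : Module.Basis (Fin n ⊕ Fin m) ℝ H.lie)
    (hskew : ∀ i, star ((c (Sum.inl i) : H.lie) : Matrix N N A) = -((c (Sum.inl i) : H.lie) : Matrix N N A))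
    (hherm : ∀ j, star ((c (Sum.inr j) : H.lie) : Matrix N N A) = ((c (Sum.inr j) : H.lie) : Matrix N N A))
    (horth : ∀ s s', thetaForm tr (c s) (c s') = if s = s' then 1 else 0)
    {φ : G → ℂ} (hφ : IsArchSmooth ι φ) (hK : IsKFinite ι φ) (hZ : IsZFinite ι φ) :
    ∃ (M : ℕ) (r : ℕ → ℝ), r M = 1 ∧
      ∑ k ∈ Finset.range (M + 1), (r k : ℂ) • (sqSumOp ι c)^[k] φ = 0 := by
  obtain ⟨χ, hχm, hχ⟩ := exists_charpoly_sqSumOp_eq_zero ι hB c hskew hherm horth hφ hK hZ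
  set q : Polynomial ℂ := χ.map (starRingEnd ℂ) * χ with hq
  have hqm : q.Monic := (hχm.map _).mul hχm
  -- the coefficients of `q = χ̄ χ` are real
  have hconj : q.map (starRingEnd ℂ) = q := by
    rw [hq, Polynomial.map_mul, Polynomial.map_map]
    have hcc : (starRingEnd ℂ).comp (starRingEnd ℂ) = RingHom.id ℂ := by
      ext z
      simp
    rw [hcc, Polynomial.map_id, mul_comm]
  have hreal : ∀ k, ((q.coeff k).re : ℂ) = q.coeff k := fun k => by
    have h := congrArg (fun p => p.coeff k) hconj
    simp only [Polynomial.coeff_map] at h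
    exact Complex.conj_eq_iff_re.1 h
  refine ⟨q.natDegree, fun k => (q.coeff k).re, ?_, ?_⟩
  · have h := hqm.coeff_natDegree
    rw [← hreal] at h
    exact_mod_cast h
  · simp only [hreal]
    exact hχ _

/-- **The adapted basis and the real annihilator, packaged.** For `𝔤` stable under the conjugate
transpose and a positive star-trace `tr` on `A`, and `φ` smooth, `K`-finite and `Z(𝔤)`-finite:
there are an adapted `B_θ`-orthonormal basis `c` of `𝔤` (skew-hermitian then hermitian vectors)
and a real monic `R` with `R(L_c) φ = 0`, `L_c = ∑ₗ cₗ²`. Borel 1972, 3.15–3.16;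
Harish-Chandra 1966, §8. [cite: Borel1972, 3.15] -/
theorem exists_adaptedBasis_real_annihilator {tr : A →ₗ[ℝ] ℝ}
    (htr : ∀ a, tr (star a) = tr a) (hpos : ∀ a : A, a ≠ 0 → 0 < tr (star a * a))
    (hstar : ∀ X : H.lie, star (X : Matrix N N A) ∈ H.lie)
    {φ : G → ℂ} (hφ : IsArchSmooth ι φ) (hK : IsKFinite ι φ) (hZ : IsZFinite ι φ) :
    ∃ (n m : ℕ) (c : Module.Basis (Fin n ⊕ Fin m) ℝ H.lie),
      (∀ i, star ((c (Sum.inl i) : H.lie) : Matrix N N A) = -((c (Sum.inl i) : H.lie) : Matrix N N A)) ∧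
      (∀ j, star ((c (Sum.inr j) : H.lie) : Matrix N N A) = ((c (Sum.inr j) : H.lie) : Matrix N N A)) ∧
      (∀ s s', thetaForm tr (c s) (c s') = if s = s' then 1 else 0) ∧
      ∃ (M : ℕ) (r : ℕ → ℝ), r M = 1 ∧
        ∑ k ∈ Finset.range (M + 1), (r k : ℂ) • (sqSumOp ι c)^[k] φ = 0 := by
  obtain ⟨n, m, c, hskew, hherm, horth⟩ := exists_adaptedBasis (H := H) htr hpos hstar
  have hB := trForm_nondegenerate (H := H) hpos hstar
  obtain ⟨M, r, hr1, hr⟩ := exists_real_annihilator_sqSumOp ι hB c hskew hherm horth hφ hK hZ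
  exact ⟨n, m, c, hskew, hherm, horth, M, r, hr1, hr⟩

end Annihilator

/-! ### §4 The annihilator of an automorphic form, in the shape used by the exponential chart -/

section Datum

variable {K : Type} [Field K] [NumberField K]
  {A : Type*} [NormedCommRing A] [NormedAlgebra ℝ A] [NormedAlgebra ℚ A] [CompleteSpace A]
  [StarRing A] [StarModule ℝ A] [ContinuousStar A] {N : Type*} [Fintype N] [DecidableEq N]
  {𝒢 : AdelicGroupData K} {𝒟 : AutomorphyDatum 𝒢 A N}

/-- **An automorphic form is annihilated by a real monic polynomial in a sum of squares of a basis
of `𝔤`** (Borel–Jacquet 1979, 4.3 (ii), via Borel 1972, 3.15–3.16 / Harish-Chandra 1966, §8: a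
`K_∞`-finite `Z(𝔤)`-finite smooth function is killed by an elliptic element of `Z(𝔤)U(𝔨)`). For a
regular datum over a finite-dimensional coefficient algebra with `ℝ`-linear involution and a
positive star-trace `tr`, and an automorphic form `φ`: there are a basis `B` of `𝔤` (indexed by
`Fin d`, in the form consumed by `ArchimedeanExpChart`), `M` and real `r₀, …, r_M` with `r_M = 1`
such that `∑ⱼ rⱼ L_B^j φ = 0` on `G(𝔸)`, `L_B ψ = ∑ᵢ Bᵢ (Bᵢ ψ)`. In every exponential chart
`∑ⱼ rⱼ L_B^j` is an elliptic operator of order `2M` with constant real coefficients in the chart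
fields. [cite: BorelJacquetCorvallis1979, 4.3 (ii)] -/
theorem IsAutomorphicForm.exists_elliptic_annihilator [FiniteDimensional ℝ A] (h𝒟 : 𝒟.IsRegular)
    {tr : A →ₗ[ℝ] ℝ} (htr : ∀ a, tr (star a) = tr a) (hpos : ∀ a : A, a ≠ 0 → 0 < tr (star a * a))
    {φ : 𝒢.Adelic → ℂ} (hφ : IsAutomorphicForm 𝒟 φ) :
    ∃ (d : ℕ) (B : Module.Basis (Fin d) ℝ 𝒟.arch.lie.toSubmodule) (M : ℕ) (r : ℕ → ℝ), r M = 1 ∧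
      ∀ x, ∑ j ∈ Finset.range (M + 1),
        (r j : ℂ) * ((sqSumOp 𝒟.ofArch (basisLie B))^[j] φ) x = 0 := by
  have hstar : ∀ X : 𝒟.arch.lie, star (X : Matrix N N A) ∈ 𝒟.arch.lie := fun X =>
    star_mem_lie_of_forall_expGL h𝒟.mem_lie_of_expGL_mem X.2
  obtain ⟨n, m, c, -, -, -, M, r, hr1, hr⟩ := exists_adaptedBasis_real_annihilator 𝒟.ofArch htr hpos
    hstar hφ.archSmooth hφ.kFinite hφ.zFinite
  -- reindex by `Fin (n + m)` and transport to the submodule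
  let B : Module.Basis (Fin (n + m)) ℝ 𝒟.arch.lie.toSubmodule :=
    (c.reindex finSumFinEquiv).map (lieEquivSubmodule 𝒟.arch)
  have hB : ∀ i, basisLie B i = c (finSumFinEquiv.symm i) := fun i => by
    refine Subtype.ext ?_
    rw [coe_basisLie]
    change ((lieEquivSubmodule 𝒟.arch (c.reindex finSumFinEquiv i) : 𝒟.arch.lie.toSubmodule) :
      Matrix N N A) = _
    rw [coe_lieEquivSubmodule, Module.Basis.reindex_apply]
  have hop : sqSumOp 𝒟.ofArch (basisLie B) = sqSumOp 𝒟.ofArch c := by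
    funext ψ
    unfold sqSumOp
    simp only [hB]
    exact Equiv.sum_comp finSumFinEquiv.symm (fun s => iterLieDeriv 𝒟.ofArch [c s, c s] ψ)
  refine ⟨n + m, B, M, r, hr1, fun x => ?_⟩
  have h := congrFun hr x
  rw [Finset.sum_apply] at h
  simpa only [hop, Pi.smul_apply, smul_eq_mul, Pi.zero_apply] using h

end Datum

end Literature.NumberTheory.Automorphic
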